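import Summits.BirchSwinnertonDyer.BirchSwinnertonDyer.Theorems.ByReductionTypeAtTwoSemistableKatoHalfSharp
import Summits.BirchSwinnertonDyer.BirchSwinnertonDyer.Theorems.ByReductionTypeAtTwoAdditivePotMultKatoHalf
import HarnessLib

/-!
# Route `ByReductionTypeAtTwo` (rung K4), the four rank-`0` cruxes at once: the UNIFORM Kato half at `2` —
# `MissingUpperBoundAt W 2` for EVERY non-CM analytic-rank-`0` curve with IRREDUCIBLE `E[2]`, whatever its reduction at `2`
# (good, multiplicative, or additive without a split multiplicative twist by `−1`/`−2`), from Coates–Sujatha's statement (A)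
# at `(E,2)` alone (seat `bsd-2adic-addL2x` GEN 14; `--supports`; outside the route file's import cone)

HONEST FRAMING (cell `bsd-2adic`, HUMAN RULING D-0036/D-0054): types-the-object-of; closes none at the ∀-level; nothing
booked; BSD is not proved by any of this. Conditional helpers; no item is closed by this file. PARTITION: no file of the
ord / ss / mult lanes is touched or restated; this is a by-name door on the irreducible-`E[2]` locus, offered zero-price.

WHAT THIS FILE DOES. The lane's four SHARP Kato-at-`2` readings — additive (NST′)
(`Kato2004.…_of_noSplitTwistNegOneNegTwo_…`, GEN 13, D-audit PASS), multiplicative and good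
(`Kato2004.…_of_multiplicative_…`, `Kato2004.…_of_good_…`, GEN 14, p658927; D-audit owed) — have ONE shape:
«non-CM, `E[2]` irreducible, (A) at `(E,2)`, `L(E,1) ≠ 0`, `Ш` finite ⟹ `ord₂ #Ш[2^∞] + v₂(Tam) ≤ ord₂(L(E,1)/Ω_E)`».
Read together they say: the reduction type at `2` is IRRELEVANT to the rank-`0` Euler-system half of BSD₂ at `2`,
except on the additive curves with a SPLIT multiplicative twist by `−1` or `−2` (Kato's 13.13 local term at a
«`σ_{−1} = +1`» prime; there `+ 2` / `+ 1`, separate files). This file types that sentence in the route's currency.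

* §1 `padicValNat_shaOrder_le_of_katoAtTwoGood_rankZero`, `missingUpperBoundAt_two_of_katoAtTwoGood` (+ `_of_isAbelianGalois`)
  — the GOOD-reduction door (ordinary or supersingular), the twin of `SemistableKatoTwo.missingUpperBoundAt_two_of_katoAtTwoMult`.
* §2 `missingUpperBoundAt_two_of_katoAtTwo_uniform` — THE UNIFORM KATO HALF: for `W` non-CM, globally minimal,
  `r_an = 0`, `E[2]` irreducible, (A) at `(W,2)`, and — only if `W` is additive at `2` — no split multiplicative twist by
  `−1` or `−2`: `MissingUpperBoundAt W 2`, by cases on the reduction at `2` (good → §1; multiplicative → GEN 14's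
  multiplicative door; additive → GEN 13's `AddKatoTwo.missingUpperBoundAt_two_of_katoAtTwoNoSplitTwist`).
* §3 `rankZeroAtTwo_upper_onIrreducible_of_conjA` — BLOCK form for the route: the Euler-system half of ALL FOUR rank-`0`
  cruxes (`GoodOrdinaryRankZeroAtTwo`, `SupersingularRankZeroAtTwo`, `MultiplicativeRankZeroAtTwo`, `AdditiveRankZeroAtTwo`)
  on {irreducible `E[2]`} ∖ {additive with a split twist by `−1`/`−2`}, from the three readings + PRINT {GZK, modularity,
  Lim@2, FW} + ONE research `∀`-object: statement (A) at `(W,2)` on the curves of that locus whose `2`-division field is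
  NOT abelian (`hAnaIrr` — Iwasawa's `μ₂ = 0` for the `S₃`-sextics `ℚ(W[2])`, the C1″-shaped object, now route-wide);
  and `rankZeroAtTwo_bsdp_onIrreducible_of_conjA_of_lower` — BSD₂ there from that + the LOWER half over `ℚ`.
Census (cell, rank `0`, non-CM, book230): irreducible `E[2]` on 1 673/1 969 multiplicative classes (mult-2), on the
`E(ℚ)[2] = 0` good-ordinary rows (tower-1's hEC locus), on all 757 supersingular classes but the reducible ones, and on
the additive block outside {(−1)-split 169, (−2)-split 39} ∪ {reducible}; numbers are context, not part of the theorems.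

Binders (BY NAME): `hKG`, `hKM` (p658927), `hNST2` (GEN 13's APPEND reading); `hGZK`; `hmod`; `hLim2`, `hFW`.
Memo: `run/shared/lean/pub/bsd-2adic/addL2x/VERDICT-19098-addL2x-GEN14.md`.

References: [Kato2004Asterisque] Thm. 12.5 (1)(3), (12.5.1) (pp. 221–222), 13.8, 13.13–13.14 (pp. 227–234), 14.13–14.16
(pp. 242–245); [SilvermanATAEC1994] V.5.3, Ex. 5.11; [Tate1975] §1; [CoatesSujatha2005] statement (A);
[Lim2017FineSelmer] §3 Thm. 3.5; [FerreroWashington1979]; [Miller2011LMS] Def. 1.1.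
-/

set_option autoImplicit false
-- sibling precedent (`ByReductionTypeAtTwoSemistableKatoHalfSharp.lean`): the directory name repeats the summit name
set_option linter.dupNamespace false

noncomputable section

open scoped Classical

namespace Summit.BirchSwinnertonDyer.BirchSwinnertonDyer.Theorems.SemistableKatoTwo

open WeierstrassCurve Literature.NumberTheory.EllipticCurves
  Literature.NumberTheory.EllipticCurves.Rank1Residual
  Literature.NumberTheory.EllipticCurves.Rank1Residual.Typed
  Literature.NumberTheory.IwasawaTheory
  Summit.BirchSwinnertonDyer.BirchSwinnertonDyer.Theses.ByReductionTypeAtTwo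
  Summit.BirchSwinnertonDyer.BirchSwinnertonDyer.Theorems.AddKatoTwo

/-! ## §1 The GOOD-reduction door -/

/-- **Rank-`0` upper bound from the `p = 2` reading at a GOOD `2`** (ordinary or supersingular): for a non-CM globally
minimal `W`, good at `2`, with `E[2]` irreducible, `r_an = 0` and statement (A) at `(E,2)`: `#Ш_an = q` and
`ord₂ #Ш ≤ ord₂ q − 2·ord₂ #E(ℚ)_tors`. Proof word for word as the multiplicative twin.
[cite: Kato2004Asterisque, Thm. 12.5 (1)(3) and (12.5.1) (pp. 221–222), 14.14 and Lemma 14.15 (pp. 243–244)]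
[cite: Tate1975, §1] [cite: CoatesSujatha2005, statement (A)] [cite: Miller2011LMS, Def. 1.1] -/
theorem padicValNat_shaOrder_le_of_katoAtTwoGood_rankZero
    (hKG : Kato2004.rankZero_padicValNat_sha_add_padicValNat_tamagawa_le_at_two_of_good_of_irreducible_of_fineSelmerDual_fg)
    (hGZK : rank_eq_analyticRank_of_analyticRank_le_one) (hmod : hasEntireLFunction_rat)
    (W : WeierstrassCurve ℚ) [W.IsElliptic] [W.IsGloballyMinimal] (hcm : ¬ W.HasCM)
    (hgood : W.HasGoodReductionAtPrime 2)
    (hirr : W.HasIrreducibleModPGaloisRep 2)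
    (hA : ∀ (κ : ZpExtension ℚ 2), κ.IsCyclotomic →
      ∃ (γ : Field.absoluteGaloisGroup ℚ) (D : W.FineSelmerDualData κ γ),
        Module.Finite ℤ_[2] (RestrictScalars ℤ_[2] (IwasawaAlgebra 2) D.X))
    (hr : W.analyticRank = 0) :
    ∃ q : ℚ, shaAn W = (q : ℂ) ∧
      (padicValNat 2 W.shaOrder : ℤ) ≤ padicValRat 2 q - 2 * padicValNat 2 W.torsionOrder := by
  have hL : W.entireLFunction 1 ≠ 0 := (W.analyticRank_eq_zero_iff_holds (hmod W)).mp hr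
  obtain ⟨hmw, hfin⟩ := hGZK W (by rw [hr]; exact zero_le_one)
  haveI : Finite W.sha := hfin
  have hmw0 : W.mordellWeilRank = 0 := by rw [hmw, hr]
  obtain ⟨q₀, hq₀, hle⟩ := hKG W hcm hgood hirr hA hL hfin
  have hΩpos : 0 < W.realPeriodRat := W.realPeriodRat_pos_holds
  have hΩ : (W.realPeriodRat : ℂ) ≠ 0 := by exact_mod_cast hΩpos.ne'
  have hc0 : 0 < W.tamagawaProduct := W.tamagawaProduct_pos_holds
  have ht0 : 0 < W.torsionOrder := W.torsionOrder_pos_holds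
  have hq₀0 : q₀ ≠ 0 := by
    rintro rfl
    rw [Rat.cast_zero, div_eq_zero_iff] at hq₀
    exact hq₀.elim hL hΩ
  refine ⟨q₀ * (W.torsionOrder : ℚ) ^ 2 / (W.tamagawaProduct : ℚ), ?_, ?_⟩
  · have hLq : W.entireLFunction 1 = (q₀ : ℂ) * (W.realPeriodRat : ℂ) := by
      rw [← hq₀, div_mul_cancel₀ _ hΩ]
    rw [shaAn_def, leadingLCoeff_eq_of_analyticRank_eq_zero W hr,
      W.regulator_eq_one_of_rank_zero hmw0, hLq]
    push_cast
    field_simp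
  · have ht : (W.torsionOrder : ℚ) ≠ 0 := by exact_mod_cast ht0.ne'
    have hcq : (W.tamagawaProduct : ℚ) ≠ 0 := by exact_mod_cast hc0.ne'
    have hsha : padicValNat 2 (Nat.card (AddCommGroup.primaryComponent W.sha 2)) =
        padicValNat 2 W.shaOrder := by
      unfold WeierstrassCurve.shaOrder
      exact padicValNat_card_addPrimaryComponent 2
    have hv : padicValRat 2 (q₀ * (W.torsionOrder : ℚ) ^ 2 / (W.tamagawaProduct : ℚ)) =
        padicValRat 2 q₀ + 2 * (padicValNat 2 W.torsionOrder : ℤ) -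
          (padicValNat 2 W.tamagawaProduct : ℤ) := by
      rw [padicValRat.div (mul_ne_zero hq₀0 (pow_ne_zero 2 ht)) hcq,
        padicValRat.mul hq₀0 (pow_ne_zero 2 ht), pow_two, padicValRat.mul ht ht,
        padicValRat.of_nat, padicValRat.of_nat]
      ring
    rw [hv, ← hsha]
    linarith

/-- **The Kato half at a curve with GOOD reduction at `2` (ordinary or supersingular) from statement (A) at `(E,2)`**,
for irreducible `E[2]`: granted the reading `hKG`, GZK and modularity, `MissingUpperBoundAt W 2`. It says nothing about
`λ/μ` at an ordinary `2` or about the signed theory at a supersingular `2`, and nothing for reducible `E[2]`.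
[cite: Kato2004Asterisque, Thm. 12.5 (1)(3) and (12.5.1) (pp. 221–222), 14.14 (p. 243)]
[cite: Tate1975, §1] [cite: CoatesSujatha2005, statement (A)] [cite: Miller2011LMS, Def. 1.1] -/
theorem missingUpperBoundAt_two_of_katoAtTwoGood
    (hKG : Kato2004.rankZero_padicValNat_sha_add_padicValNat_tamagawa_le_at_two_of_good_of_irreducible_of_fineSelmerDual_fg)
    (hGZK : rank_eq_analyticRank_of_analyticRank_le_one) (hmod : hasEntireLFunction_rat)
    (W : WeierstrassCurve ℚ) [W.IsElliptic] [W.IsGloballyMinimal] (hcm : ¬ W.HasCM) (hr : W.analyticRank = 0)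
    (hgood : W.HasGoodReductionAtPrime 2) (hirr : W.HasIrreducibleModPGaloisRep 2)
    (hA : ∀ (κ : ZpExtension ℚ 2), κ.IsCyclotomic →
      ∃ (γ : Field.absoluteGaloisGroup ℚ) (D : W.FineSelmerDualData κ γ),
        Module.Finite ℤ_[2] (RestrictScalars ℤ_[2] (IwasawaAlgebra 2) D.X)) :
    MissingUpperBoundAt W 2 := by
  haveI : Fact (Nat.Prime 2) := ⟨Nat.prime_two⟩
  obtain ⟨q, hq, hle⟩ :=
    padicValNat_shaOrder_le_of_katoAtTwoGood_rankZero hKG hGZK hmod W hcm hgood hirr hA hr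
  rw [padicValNat_torsionOrder_eq_zero_of_irreducible W 2 hirr] at hle
  simp only [Nat.cast_zero, mul_zero, sub_zero] at hle
  exact ⟨q, hq, hle⟩

/-- **The Kato half at a GOOD `2` with statement (A) DISCHARGED from print when `ℚ(E[2])` is abelian** (cyclic cubic
image): Lim 2017 Thm. 3.5 at `2` + Ferrero–Washington BY NAME (`conjA_two_of_isAbelianGalois_divisionField_two`).
[cite: Lim2017FineSelmer, §3 Thm. 3.5] [cite: FerreroWashington1979, Theorem] [cite: Kato2004Asterisque, Thm. 12.5 (3) and (12.5.1) (p. 222)] -/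
theorem missingUpperBoundAt_two_of_katoAtTwoGood_of_isAbelianGalois
    (hKG : Kato2004.rankZero_padicValNat_sha_add_padicValNat_tamagawa_le_at_two_of_good_of_irreducible_of_fineSelmerDual_fg)
    (hGZK : rank_eq_analyticRank_of_analyticRank_le_one) (hmod : hasEntireLFunction_rat)
    (hLim2 : Lim2017.thm35_at_two_fineSelmerDual_moduleFinite_of_classicalMuVanishes_of_le_divisionField_four)
    (hFW : ferreroWashington1979_classicalMuVanishes)
    (W : WeierstrassCurve ℚ) [W.IsElliptic] [W.IsGloballyMinimal] (hcm : ¬ W.HasCM) (hr : W.analyticRank = 0)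
    (hgood : W.HasGoodReductionAtPrime 2) (hirr : W.HasIrreducibleModPGaloisRep 2)
    (hab : IsAbelianGalois ℚ (W.divisionField 2)) :
    MissingUpperBoundAt W 2 := by
  haveI := hab
  exact missingUpperBoundAt_two_of_katoAtTwoGood hKG hGZK hmod W hcm hr hgood hirr
    (conjA_two_of_isAbelianGalois_divisionField_two hLim2 hFW W)

/-! ## §2 The UNIFORM Kato half at `2` -/

/-- **THE UNIFORM KATO HALF AT `2`.** For every non-CM globally minimal `W` of analytic rank `0` with IRREDUCIBLE `E[2]`,
statement (A) at `(W,2)` gives the Euler-system half `MissingUpperBoundAt W 2` — WHATEVER the reduction of `W` at `2`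
(good ordinary, good supersingular, split or non-split multiplicative, additive potentially good or potentially
multiplicative), provided only that, if `W` is additive at `2`, neither `W^{(−1)}` nor `W^{(−2)}` is split multiplicative
at `2` (hypothesis `hnst`, vacuous at a semistable `2`). Granted the three readings `hKG`, `hKM`, `hNST2`, GZK and
modularity; by cases on the reduction at `2`. [cite: Kato2004Asterisque, Thm. 12.5 (1)(3) and (12.5.1) (pp. 221–222), 13.13 (pp. 233–234), 14.14 (p. 243)]
[cite: SilvermanATAEC1994, Thm. V.5.3 and Exercise 5.11] [cite: Tate1975, §1] [cite: CoatesSujatha2005, statement (A)]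
[cite: Miller2011LMS, Def. 1.1] -/
theorem missingUpperBoundAt_two_of_katoAtTwo_uniform
    (hKG : Kato2004.rankZero_padicValNat_sha_add_padicValNat_tamagawa_le_at_two_of_good_of_irreducible_of_fineSelmerDual_fg)
    (hKM : Kato2004.rankZero_padicValNat_sha_add_padicValNat_tamagawa_le_at_two_of_multiplicative_of_irreducible_of_fineSelmerDual_fg)
    (hNST2 : Kato2004.rankZero_padicValNat_sha_add_padicValNat_tamagawa_le_at_two_of_noSplitTwistNegOneNegTwo_of_irreducible_of_fineSelmerDual_fg)
    (hGZK : rank_eq_analyticRank_of_analyticRank_le_one) (hmod : hasEntireLFunction_rat)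
    (W : WeierstrassCurve ℚ) [W.IsElliptic] [W.IsGloballyMinimal] (hcm : ¬ W.HasCM) (hr : W.analyticRank = 0)
    (hirr : W.HasIrreducibleModPGaloisRep 2)
    (hnst : Addv W 2 → ∀ d : ℚ, d = -1 ∨ d = -2 → ¬ (W.quadraticTwist d).HasSplitMultiplicativeReductionAtPrime 2)
    (hA : ∀ (κ : ZpExtension ℚ 2), κ.IsCyclotomic →
      ∃ (γ : Field.absoluteGaloisGroup ℚ) (D : W.FineSelmerDualData κ γ),
        Module.Finite ℤ_[2] (RestrictScalars ℤ_[2] (IwasawaAlgebra 2) D.X)) :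
    MissingUpperBoundAt W 2 := by
  haveI : Fact (Nat.Prime 2) := ⟨Nat.prime_two⟩
  by_cases hgood : W.HasGoodReductionAtPrime 2
  · exact missingUpperBoundAt_two_of_katoAtTwoGood hKG hGZK hmod W hcm hr hgood hirr hA
  · by_cases hmult : W.HasMultiplicativeReductionAtPrime 2
    · exact missingUpperBoundAt_two_of_katoAtTwoMult hKM hGZK hmod W hcm hr hmult hirr hA
    · have hadd : Addv W 2 := ⟨hgood, hmult⟩
      exact missingUpperBoundAt_two_of_katoAtTwoNoSplitTwist hNST2 hGZK hmod W hcm hr hadd (hnst hadd) hirr hA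

/-- **The uniform Kato half with (A) DISCHARGED from print when `ℚ(E[2])` is abelian** (cyclic cubic image): PRINT + the
three readings only. [cite: Lim2017FineSelmer, §3 Thm. 3.5] [cite: FerreroWashington1979, Theorem]
[cite: Kato2004Asterisque, Thm. 12.5 (3) and (12.5.1) (p. 222), 13.13 (p. 233)] -/
theorem missingUpperBoundAt_two_of_katoAtTwo_uniform_of_isAbelianGalois
    (hKG : Kato2004.rankZero_padicValNat_sha_add_padicValNat_tamagawa_le_at_two_of_good_of_irreducible_of_fineSelmerDual_fg)
    (hKM : Kato2004.rankZero_padicValNat_sha_add_padicValNat_tamagawa_le_at_two_of_multiplicative_of_irreducible_of_fineSelmerDual_fg)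
    (hNST2 : Kato2004.rankZero_padicValNat_sha_add_padicValNat_tamagawa_le_at_two_of_noSplitTwistNegOneNegTwo_of_irreducible_of_fineSelmerDual_fg)
    (hGZK : rank_eq_analyticRank_of_analyticRank_le_one) (hmod : hasEntireLFunction_rat)
    (hLim2 : Lim2017.thm35_at_two_fineSelmerDual_moduleFinite_of_classicalMuVanishes_of_le_divisionField_four)
    (hFW : ferreroWashington1979_classicalMuVanishes)
    (W : WeierstrassCurve ℚ) [W.IsElliptic] [W.IsGloballyMinimal] (hcm : ¬ W.HasCM) (hr : W.analyticRank = 0)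
    (hirr : W.HasIrreducibleModPGaloisRep 2)
    (hnst : Addv W 2 → ∀ d : ℚ, d = -1 ∨ d = -2 → ¬ (W.quadraticTwist d).HasSplitMultiplicativeReductionAtPrime 2)
    (hab : IsAbelianGalois ℚ (W.divisionField 2)) :
    MissingUpperBoundAt W 2 := by
  haveI := hab
  exact missingUpperBoundAt_two_of_katoAtTwo_uniform hKG hKM hNST2 hGZK hmod W hcm hr hirr hnst
    (conjA_two_of_isAbelianGalois_divisionField_two hLim2 hFW W)

/-! ## §3 BLOCK forms for the route: the Euler-system half of the four rank-`0` cruxes on the irreducible locus -/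

/-- **The Euler-system half of ALL FOUR rank-`0` cruxes of the route on the irreducible-`E[2]` locus off the two twist
classes**, from the three readings + PRINT {GZK, modularity, Lim@2, FW} + ONE research `∀`-object `hAnaIrr` =
statement (A) at `(W,2)` on the non-CM rank-`0` curves with irreducible `E[2]` and NON-abelian `ℚ(E[2])` (Iwasawa's
`μ₂ = 0` for the `S₃`-sextics `ℚ(W[2])` by the class-group criterion; the C1″-shaped object of the additive split, now
stated route-wide). Conditional; closes nothing. [cite: Kato2004Asterisque, Thm. 12.5 (3) and (12.5.1) (p. 222), 13.13 (p. 233), 14.14 (p. 243)]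
[cite: CoatesSujatha2005, statement (A)] [cite: Lim2017FineSelmer, §3 Thm. 3.5] [cite: FerreroWashington1979, Theorem] -/
theorem rankZeroAtTwo_upper_onIrreducible_of_conjA
    (hKG : Kato2004.rankZero_padicValNat_sha_add_padicValNat_tamagawa_le_at_two_of_good_of_irreducible_of_fineSelmerDual_fg)
    (hKM : Kato2004.rankZero_padicValNat_sha_add_padicValNat_tamagawa_le_at_two_of_multiplicative_of_irreducible_of_fineSelmerDual_fg)
    (hNST2 : Kato2004.rankZero_padicValNat_sha_add_padicValNat_tamagawa_le_at_two_of_noSplitTwistNegOneNegTwo_of_irreducible_of_fineSelmerDual_fg)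
    (hGZK : rank_eq_analyticRank_of_analyticRank_le_one) (hmod : hasEntireLFunction_rat)
    (hLim2 : Lim2017.thm35_at_two_fineSelmerDual_moduleFinite_of_classicalMuVanishes_of_le_divisionField_four)
    (hFW : ferreroWashington1979_classicalMuVanishes)
    (hAnaIrr : ∀ (W : WeierstrassCurve ℚ) [W.IsElliptic] [W.IsGloballyMinimal], ¬ W.HasCM → W.analyticRank = 0 →
      W.HasIrreducibleModPGaloisRep 2 → ¬ IsAbelianGalois ℚ (W.divisionField 2) →
      ∀ (κ : ZpExtension ℚ 2), κ.IsCyclotomic →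
        ∃ (γ : Field.absoluteGaloisGroup ℚ) (D : W.FineSelmerDualData κ γ),
          Module.Finite ℤ_[2] (RestrictScalars ℤ_[2] (IwasawaAlgebra 2) D.X)) :
    ∀ (W : WeierstrassCurve ℚ) [W.IsElliptic] [W.IsGloballyMinimal], ¬ W.HasCM → W.analyticRank = 0 →
      W.HasIrreducibleModPGaloisRep 2 →
      (Addv W 2 → ∀ d : ℚ, d = -1 ∨ d = -2 → ¬ (W.quadraticTwist d).HasSplitMultiplicativeReductionAtPrime 2) →
      MissingUpperBoundAt W 2 := by
  intro W _ _ hcm hr hirr hnst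
  by_cases hab : IsAbelianGalois ℚ (W.divisionField 2)
  · exact missingUpperBoundAt_two_of_katoAtTwo_uniform_of_isAbelianGalois hKG hKM hNST2 hGZK hmod hLim2 hFW W hcm hr
      hirr hnst hab
  · exact missingUpperBoundAt_two_of_katoAtTwo_uniform hKG hKM hNST2 hGZK hmod W hcm hr hirr hnst
      (hAnaIrr W hcm hr hirr hab)

/-- **BSD₂ on the same locus from that Kato half and the LOWER half over `ℚ`** (`hLowIrr`, the Eisenstein-side research
object, route-wide on the irreducible locus): `missingPPartAt_of_lower_of_upper` + `bsdp_of_missingPPartAt`. So on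
{non-CM, `r_an = 0`, irreducible `E[2]`} ∖ {additive with a split twist by `−1`/`−2`} the rung-K4 leaf has the SAME
one-sided residual shape {(A) on `S₃`-image, lower half} for all four reduction types. Conditional; closes nothing.
[cite: Kato2004Asterisque, Thm. 12.5 (3) (p. 222), 14.14 (p. 243)] [cite: CoatesSujatha2005, statement (A)]
[cite: Miller2011LMS, §1 and Def. 1.1] -/
theorem rankZeroAtTwo_bsdp_onIrreducible_of_conjA_of_lower
    (hKG : Kato2004.rankZero_padicValNat_sha_add_padicValNat_tamagawa_le_at_two_of_good_of_irreducible_of_fineSelmerDual_fg)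
    (hKM : Kato2004.rankZero_padicValNat_sha_add_padicValNat_tamagawa_le_at_two_of_multiplicative_of_irreducible_of_fineSelmerDual_fg)
    (hNST2 : Kato2004.rankZero_padicValNat_sha_add_padicValNat_tamagawa_le_at_two_of_noSplitTwistNegOneNegTwo_of_irreducible_of_fineSelmerDual_fg)
    (hGZK : rank_eq_analyticRank_of_analyticRank_le_one) (hmod : hasEntireLFunction_rat)
    (hLim2 : Lim2017.thm35_at_two_fineSelmerDual_moduleFinite_of_classicalMuVanishes_of_le_divisionField_four)
    (hFW : ferreroWashington1979_classicalMuVanishes)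
    (hAnaIrr : ∀ (W : WeierstrassCurve ℚ) [W.IsElliptic] [W.IsGloballyMinimal], ¬ W.HasCM → W.analyticRank = 0 →
      W.HasIrreducibleModPGaloisRep 2 → ¬ IsAbelianGalois ℚ (W.divisionField 2) →
      ∀ (κ : ZpExtension ℚ 2), κ.IsCyclotomic →
        ∃ (γ : Field.absoluteGaloisGroup ℚ) (D : W.FineSelmerDualData κ γ),
          Module.Finite ℤ_[2] (RestrictScalars ℤ_[2] (IwasawaAlgebra 2) D.X))
    (hLowIrr : ∀ (W : WeierstrassCurve ℚ) [W.IsElliptic] [W.IsGloballyMinimal], ¬ W.HasCM → W.analyticRank = 0 →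
      W.HasIrreducibleModPGaloisRep 2 → MissingLowerBoundAt W 2) :
    ∀ (W : WeierstrassCurve ℚ) [W.IsElliptic] [W.IsGloballyMinimal], ¬ W.HasCM → W.analyticRank = 0 →
      W.HasIrreducibleModPGaloisRep 2 →
      (Addv W 2 → ∀ d : ℚ, d = -1 ∨ d = -2 → ¬ (W.quadraticTwist d).HasSplitMultiplicativeReductionAtPrime 2) →
      BSDp W 2 := by
  intro W _ _ hcm hr hirr hnst
  have hr1 : W.analyticRank ≤ 1 := by rw [hr]; exact zero_le_one
  exact bsdp_of_missingPPartAt W 2 hGZK hr1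
    (missingPPartAt_of_lower_of_upper W 2 (hLowIrr W hcm hr hirr)
      (rankZeroAtTwo_upper_onIrreducible_of_conjA hKG hKM hNST2 hGZK hmod hLim2 hFW hAnaIrr W hcm hr hirr hnst))

end Summit.BirchSwinnertonDyer.BirchSwinnertonDyer.Theorems.SemistableKatoTwo

end
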